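import Summits.ResolutionOfSingularities.ResolutionOfSingularities.Theorems.FrobeniusLadderFInjectiveMacaulayficationPointFixableCentre
import Summits.ResolutionOfSingularities.ResolutionOfSingularities.Theorems.FrobeniusLadderFInjectiveMacaulayficationFTemkinClosedPoints
import Summits.ResolutionOfSingularities.ResolutionOfSingularities.Theorems.FrobeniusLadderFInjectiveMacaulayficationGermOfGlobalBlowup
import HarnessLib

/-!
# POINT-FIXABLE ⇒ THE GERM FORM'S CONCLUSION: `PFix(𝒪_{X,b})` at an isolated singular point gives `GermForm.FInjectivizationGermAt p b`
# (crux `FInjectiveMacaulayfication` stmt-ResolutionOfSingularities-15315, chain w45a; this seat's second offer 2026-08-28T02:31Z / 02:47Z,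
# res-L1-w45a-tri-2 #347 «S-INSTANCE-worthy» + pre-audit question answered 02:46Z; bridge routed through res-L1-w45a-stub-1 g9's
# `GermOfGlobalBlowup.fInjectivizationGermAt_of_isBlowup_of_ne_bot` (p599230) to avoid a second flat-base-change proof; seat res-L1-w45a-stub-3 g8)

[OURS · L1 W4.5a] Support file (`--supports stmt-ResolutionOfSingularities-15315 --as helper`); replaces the role of NO printed item; NOT a
statement of any manuscript; def-free, no named facts. AI-written (AI review is weaker than expert review).

The chain's road-B / K-T4 certificates (toric fans, K-loc cells) land in the RING-LOCAL point-fixability currency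
`PFix(𝒪_{X,b})` — an `𝔪_b`-primary `(c) ≠ 0` all of whose affine blow-up algebras `𝒪_b[(c)/c_j]` satisfy the FULL stalk clause (domain ∧
CM-clause ∧ F-clause, `SliceableCentre.FullCl p` unfolded) at every prime over `𝔪_b` — e.g. `T4OriginPointFixableChar7.t4_originPointFixable_char7`
(537 charts). This file converts that currency into the F-half's germ currency `GermForm.FInjectivizationGermAt p b` (res-L1-w45a-stub-1 p596392):

* §1 `centreData_of_pointFixable` — PFix(𝒪_b) at a CLOSED point `b` of a locally Noetherian `X` ⇒ an ideal sheaf `J ≠ ⊥` with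
  `supp J = {b}` EXACTLY (the equality `PointFixableCentre.pointFixable_h4` discards) all of whose blowings up are FULL at every point over `b`
  (spread the centre to an affine neighbourhood, `PointCentreIdealSheaf.stub_pointCentreIdealSheaf`; Stacks 0804 dictionary
  `IsBlowup.exists_blowupAlgebra_stalk_ringEquiv_of_eq`).
* §2 `fInjectivizationGermAt_of_pointFixable` — for `X` integral, locally of finite type over a field of characteristic `p`, `b` closed with all
  PROPER generisations regular (the germ is an isolated singularity) and PFix(𝒪_{X,b}): `GermForm.FInjectivizationGermAt p b`. Over `b` the
  blowing up along `J` is FULL by PFix; over a proper generisation `y` of `b` it is an isomorphism near the point (`IsBlowup.isIso_compl`,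
  `supp J = {b}`) and `𝒪_{X,y}` is regular, hence FULL (`FiClauseOfRegular` through `FTemkinClosedPoints.fullCl_of_isRegularLocalRing`); then
  `GermOfGlobalBlowup.fInjectivizationGermAt_of_isBlowup_of_ne_bot`. No Fedder-type fact is load-bearing here (Fedder lives inside the
  certificates that produce PFix).

[folklore assembly; cite: StacksProject, Tag 0804, Tag 0805, Tag 01J7; Temkin2008, §2.1; Matsumura1987, Thm. 17.4]
-/

-- single-problem summit: the doubled namespace component is forced
set_option linter.dupNamespace false

noncomputable section

namespace Summit.ResolutionOfSingularities.ResolutionOfSingularities.Theorems.FInjectiveMacaulayfication.GermOfPointFixable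

open AlgebraicGeometry CategoryTheory Literature.AlgebraicGeometry.Resolution TopologicalSpace
open Summit.ResolutionOfSingularities.ResolutionOfSingularities.Theorems.FInjectiveMacaulayfication
open SliceableCentre

/-- **PFix(𝒪_b) ⇒ a point-supported FULL-ifying centre, with the support recorded EXACTLY.** For a locally Noetherian scheme `X`, a
CLOSED point `b` and point-fixability data at `b` — an `𝔪_b`-primary `(c) ≠ 0` in `𝒪_{X,b}` all of whose affine blow-up algebras
`𝒪_b[(c)/c_j]` satisfy the full stalk clause at the primes over `𝔪_b` — there is an ideal sheaf `J ≠ ⊥` with `supp J = {b}`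
(equality, not just `b ∈ supp J` as in `PointFixableCentre.pointFixable_h4`) such that EVERY blowing up along `J` is FULL
(`SliceableCentre.FullCl p`) at every point over `b`. Same proof as `pointFixable_h4` (spread the centre to an affine
neighbourhood, `PointCentreIdealSheaf.stub_pointCentreIdealSheaf`, Stacks 0804 dictionary
`IsBlowup.exists_blowupAlgebra_stalk_ringEquiv_of_eq`), keeping the support equality it discards. [folklore; cite: StacksProject, Tag 0804] -/
theorem centreData_of_pointFixable (p : ℕ) {X : Scheme.{0}} [IsLocallyNoetherian X] (b : X) (hb : IsClosed ({b} : Set X))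
    (hfix : ∃ (n : ℕ) (c : Fin n → X.presheaf.stalk b), Ideal.span (Set.range c) ≠ ⊥ ∧
      (Ideal.span (Set.range c)).radical = IsLocalRing.maximalIdeal (X.presheaf.stalk b) ∧
      ∀ (j : Fin n) (𝔔 : PrimeSpectrum (blowupAlgebra (Ideal.span (Set.range c)) (c j))),
        𝔔.asIdeal.comap (algebraMap (X.presheaf.stalk b) (blowupAlgebra (Ideal.span (Set.range c)) (c j))) =
          IsLocalRing.maximalIdeal (X.presheaf.stalk b) →
        FullCl p (Localization.AtPrime 𝔔.asIdeal)) :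
    ∃ J : X.IdealSheafData, J ≠ ⊥ ∧ (J.support : Set X) = {b} ∧
      ∀ (X' : Scheme.{0}) (π : X' ⟶ X), IsBlowup π J → ∀ x' : X', π.base x' = b → FullCl p (X'.presheaf.stalk x') := by
  obtain ⟨n, c, hc0, hrad, hgood⟩ := hfix
  -- an affine open around `b`; the germ map is the localization at `𝔭_b`
  obtain ⟨U₀, hU₀, hbU, -⟩ := exists_isAffineOpen_mem_and_subset (X := X) (x := b) (U := ⊤) (Opens.mem_top b)
  let U : X.affineOpens := ⟨U₀, hU₀⟩
  letI := TopCat.Presheaf.algebra_section_stalk X.presheaf (⟨b, hbU⟩ : (U : X.Opens))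
  haveI : IsLocalization.AtPrime (X.presheaf.stalk b) (U.2.primeIdealOf ⟨b, hbU⟩).asIdeal :=
    U.2.isLocalization_stalk ⟨b, hbU⟩
  -- spread the centre out to `U`
  have hmap : ((Ideal.span (Set.range c)).under Γ(X, U)).map (algebraMap Γ(X, U) (X.presheaf.stalk b)) =
      Ideal.span (Set.range c) :=
    IsLocalization.map_under (U.2.primeIdealOf ⟨b, hbU⟩).asIdeal.primeCompl (X.presheaf.stalk b) _
  have hI0 : (Ideal.span (Set.range c)).under Γ(X, U) ≠ ⊥ := fun h => hc0 (by rw [← hmap, h, Ideal.map_bot])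
  have hzero : ∀ (x : X) (hx : x ∈ (U : X.Opens)),
      (Ideal.span (Set.range c)).under Γ(X, U) ≤ (U.2.primeIdealOf ⟨x, hx⟩).asIdeal ↔ x = b :=
    fun x hx => PointFixableCentre.under_le_primeIdealOf_iff X U b hbU hb _ hrad x hx
  -- the point-centre ideal sheaf of the spread-out centre
  obtain ⟨J, hJU, hsupp, -⟩ := PointCentreIdealSheaf.stub_pointCentreIdealSheaf X U _ b hbU hb hzero
  refine ⟨J, fun hbot => hI0 (by rw [← hJU, hbot]; rfl), hsupp, fun X' π hπ x' hx' => ?_⟩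
  subst hx'
  -- `J_b = (c)` and the dictionary: `𝒪_{X',x'} ≅ (𝒪_b[(c)/c_j])_𝔔` with `𝔔` over `𝔪_b`
  have hst : stalkIdeal J (π.base x') = Ideal.span (Set.range c) := by
    rw [stalkIdeal_eq_map_germ J U hbU, hJU]
    exact hmap
  obtain ⟨j, 𝔔, -, e, -, -, -, h𝔔⟩ :=
    hπ.exists_blowupAlgebra_stalk_ringEquiv_of_eq x' c (Ideal.span (Set.range c)) rfl hst.symm
  exact WFixAtNonClosedDimTwo.fullCl_of_ringEquiv p e.symm (hgood j 𝔔 h𝔔)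

/-! ## §2 The germ bridge: PFix(𝒪_b) + «proper generisations of `b` are regular» ⇒ `GermForm.FInjectivizationGermAt p b` -/

/-- **POINT-FIXABLE ⇒ THE GERM FORM'S CONCLUSION.** Let `X` be integral and locally of finite type over a field `k` of characteristic
`p`, `b ∈ X` a CLOSED point all of whose proper generisations are regular points of `X` (the germ `Spec 𝒪_{X,b}` is regular off its
closed point), and assume PFix(𝒪_{X,b}) (ring-local point-fixability: an `𝔪_b`-primary `(c) ≠ 0` whose affine blow-up algebras are FULL
at the primes over `𝔪_b` — the shape certified chart by chart by the K-T4 / road-B toric certificates, e.g.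
`T4OriginPointFixableChar7.t4_originPointFixable_char7`). Then `GermForm.FInjectivizationGermAt p b`: the base change
`S₀ := X′ ×_X Spec 𝒪_{X,b} → Spec 𝒪_{X,b}` of a blowing up `X′ → X` along the point-supported centre `J` of
`centreData_of_pointFixable` is a blowing up along `J·𝒪_{X,b}` (flat base change, `IsBlowup.pullback_snd_of_flat`), cosupported at the
closed point and `≠ ⊥`; its points lie over generisations of `b` (`range_pullback_fst_fromSpecStalk`) with the local rings of `X′`
(`isIso_stalkMap_pullback_fst_fromSpecStalk`): FULL over `b` by PFix, and REGULAR — hence FULL (`FiClauseOfRegular`) — over the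
proper generisations, where `X′ → X` is an isomorphism (`IsBlowup.isIso_compl`). One model suffices
(`GermForm.fInjectivizationGermAt_of_model`). [folklore assembly; cite: StacksProject, Tag 0804, Tag 0805, Tag 01J7; Temkin2008, §2.1] -/
theorem fInjectivizationGermAt_of_pointFixable (p : ℕ) [Fact p.Prime] {k : Type} [Field k] [CharP k p]
    {X : Scheme.{0}} (f₀ : X ⟶ Spec (.of k)) [LocallyOfFiniteType f₀] [IsIntegral X]
    (b : X) (hb : IsClosed ({b} : Set X)) (hgen : ∀ y : X, y ⤳ b → y ≠ b → y ∈ Scheme.regularLocus X)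
    (hfix : ∃ (n : ℕ) (c : Fin n → X.presheaf.stalk b), Ideal.span (Set.range c) ≠ ⊥ ∧
      (Ideal.span (Set.range c)).radical = IsLocalRing.maximalIdeal (X.presheaf.stalk b) ∧
      ∀ (j : Fin n) (𝔔 : PrimeSpectrum (blowupAlgebra (Ideal.span (Set.range c)) (c j))),
        𝔔.asIdeal.comap (algebraMap (X.presheaf.stalk b) (blowupAlgebra (Ideal.span (Set.range c)) (c j))) =
          IsLocalRing.maximalIdeal (X.presheaf.stalk b) →
        FullCl p (Localization.AtPrime 𝔔.asIdeal)) :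
    GermForm.FInjectivizationGermAt p b := by
  classical
  haveI : IsLocallyNoetherian X := LocallyOfFiniteType.isLocallyNoetherian f₀
  obtain ⟨J, hJne, hsupp, hfull⟩ := centreData_of_pointFixable p b hb hfix
  obtain ⟨X', π, hπ⟩ := exists_isBlowup X J
  refine GermOfGlobalBlowup.fInjectivizationGermAt_of_isBlowup_of_ne_bot p b hπ hJne
    (fun y hy _ => by rw [hsupp] at hy; exact hy) fun x' hx' => ?_
  by_cases hxb : π.base x' = b
  · -- over `b`: FULL by point-fixability
    exact hfull X' π hπ x' hxb
  · -- over a proper generisation of `b`: `π` is an isomorphism there and `X` is regular there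
    have h1 : π.base x' ∈ Scheme.regularLocus X := hgen _ hx' hxb
    have h2 : π.base x' ∉ (J.support : Set X) := by rw [hsupp]; exact hxb
    haveI := hπ.isIso_compl
    have hreg : x' ∈ Scheme.regularLocus X' :=
      (mem_regularLocus_iff_of_isIso_morphismRestrict π ⟨(J.support : Set X)ᶜ, J.support.isClosed.isOpen_compl⟩ _ h2).mpr h1
    rw [Scheme.mem_regularLocus] at hreg
    haveI := hreg
    haveI := FTemkinClosedPoints.charP_stalk_of_over p f₀ π x'
    exact FTemkinClosedPoints.fullCl_of_isRegularLocalRing p _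

end Summit.ResolutionOfSingularities.ResolutionOfSingularities.Theorems.FInjectiveMacaulayfication.GermOfPointFixable

end
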